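import Summits.QuantumFields.YangMills.Theorems.BalabanUVNodesSpineReadingOfRecord13CoPHKRatioDominationBankedChronoOfRecordCeilingPerRegionAE
import Summits.QuantumFields.YangMills.Theorems.BalabanUVNodesN20DressedLettersOfUndressedAE

/-!
# N20 (NE7b) ON THE TOWER-FREE ROAD, THE FACE OF RECORD ON THE LIVE LINE IN PRINT'S UNDRESSED CURRENCY: margins `κ₁, E₀` and a coupling ceiling `γ₀ > 0` from the
# constants, then — for every carrier tuple ON THE LIVE LINE whose histories of record stay in `]0, γ₀]` and obey (2.7) — ONE removal schedule per cutoff `K` with ONE-COMPONENT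
# letters `dV`-almost everywhere ON THE RECORD'S OWN UNDRESSED (2.18) SLOTS (no source `t`, no loop string `os`), the data and labels (b), the multiplicities (ID) and the cut
# give `RelWeightBound`; the four regularity rows (C) are theorems there

Cell `pub-ymgap`, YM-PLAN Track A (HUMAN RULING D-0062); seat `pub-ymgap-dag-n20-d` (R134 (a) N20 NE7b s3 — «alternative currency»), gen 45 — director-ym №374 line (E), road [e]
TOWER-FREE of record (№377); dag-lead WORDS 499 GO.  `--kind proof --supports stmt-QuantumFields-27366 --as helper` (K3⁸); COUNT-NEUTRAL helper ∕ NOT a discharge; THEOREMS ONLY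
(0 `def`).  [III] = [Balaban1988Convergent]; [LF-II] = [Balaban1989LargeFieldII]; [IV] = [Balaban1989LargeFieldI].  Companions BY NAME: ✓p786169
`…CeilingPerRegionAE.exists_margins_smallCoupling_relWeightBound_chronoGenealogies_ofRecord_perRegionAE` (gen 44: the face with DRESSED per-`(K, t, os)` a.e. letters),
`…N20DressedLettersOfUndressedAE` (gen 45: the dressed letters at every `|t| ≤ 1`, `os` from the undressed one on the live line; the pieces' measurability), dag-n21-d's
`…N21ShellSplitOfRecord13CoPHKeyed` §6 (`integrable_topPieceA∕B_of_liveSel`).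

WHY (the `t`-FREE, `os`-FREE currency — print's own terms).  ✓p786169 asks item (a′) — the one-component relative letters, [LF-II] (1.79)∕(1.89)-improved KIND on [IV] (0.3)'s fibre,
`dV`-a.e. — for F3's DRESSED pieces `χ(s)·dressedSlotsOfDatum₉ θ (datum) g₀ os t (run) (hist)` at EVERY source `|t| ≤ 1` and EVERY loop string `os`, together with its schedules: one
family per `(K, t, os)`.  [LF-II] has no dressing (the dressing `e^{t·F_os}` is [King1986]'s generating-function device, N15's road); its (1.79)∕(1.89) and (B)'s §2 [III] form —
`Node00.SLaw₁₃CoPH θ p k`, what a K3⁸ stub-2 prover holds under the item's own prefix `(B) → END → ForSmallCouplings` by `B16.Thm1Printed` and the tuning — speak about the record's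
OWN post-𝐑 (2.18) slot family `slotsOfRecord … (EOfRecord₁₃ θ) (wOfRecord₉ θ) θ.ppSel (run) (gOfRecord₁₃ θ run)`.  On the live line the dressed letters at all `(t, os)` follow from ONE
letter family on that undressed family with factor `e^{−2}·raw` (`…N20DressedLettersOfUndressedAE`: n19-c's vacuum identity and `e^{∓|t|}` sandwich, an a.e. transfer under
integrability); and the faces' regularity rows (C) are theorems there (dag-n21-d §6, n19-c).  So the face is restated with (a′) := per cutoff `K` ONLY, a removal SCHEDULE per bad
history and ONE-COMPONENT LETTERS ON THE UNDRESSED SLOTS OF RECORD «`∫⌈_{fibY Y} χ(u_i)·u(u_i) ≤ e^{−2}·e^{−credits(G Y)}·e^{+lifeCost(G Y)}·∫⌈_{fibY Y} χ(u_{i+1})·u(u_{i+1})` for `dV`-a.e.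
configuration, `Y = comp s i`», and the three live-line rows `hsel` (K3⁸ v7's `LiveSel`), (H-U) `LocalBgMeasurable θ.ν`, `0 ≤ θ.ζ` — exactly the rows under which this lineage's
`keyedExtraction_crOfRecord₁₃At` (E1 ∕ E2) and dag-n21-d's N21 face are theorems, i.e. rows the K3⁸ knit displays ALREADY.  GONE against ✓p786169: `t` and `os` from item (a′) and
from the schedules (one family per `K` serves every `|t| ≤ 1` and every `os`), and the four rows (C).  Neither face implies the other as a statement (the live-line rows are new
hypotheses; the letters are weaker in number and carry print's objects); this is the edition a reader of [LF-II] pp. 383–387 can compare term by term.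

WHAT IS PROVED (kernel; zero `sorry`).  ★★★ `exists_margins_smallCoupling_relWeightBound_chronoGenealogies_ofRecord_undressedAE_of_liveSel` (✓p786169 ∘ per `(K, t)`: the `t`-free
data, each dressed link letter by `dressedLetterAE_of_undressedLetterAE_A∕_B`; rows (C) by `measurable_chi_mul_dressedSlotsOfDatum₉_A∕_B` and `integrable_topPieceA∕B_of_liveSel`;
the bad class `badClassK₁₃ … K t` does not read `t`).

WHAT STAYS DISPLAYED (NOT PRINTED as theorems of [LF-II] for `d = 4`, NOT proved here): (a′) the ONE-COMPONENT relative letters `dV`-a.e. ON THE UNDRESSED SLOTS OF RECORD along the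
schedules — [LF-II] (1.79)∕(1.89)-improved KIND read RELATIVELY on [IV] (0.3)'s fibre (junction NC-NE7b-α UNRULED; `pub-balaban`'s R3′; object-bound (A1c): def-T's recursion ∕
the §2 form's residual maps) — and the schedules themselves (DEFINER, with (b)); (b) slot filing, genealogy LABELS; (ID) multiplicities and caps; (F) slopes, histories of record in
`]0, γ₀]` (under K3⁸'s prefix this IS the tuning binder, `flow_g_datumOfRecord₁₃CoPH`) and (2.7) (B14's currency); the cut `j⋆`, `c`; the live line `hsel` + (H-U) + `0 ≤ θ.ζ`
(K0′ ∕ K3⁸ rows); `hP : θ.Provisos₁₃CoPH` (K0⁷).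

HONEST FRAMING.  [bookkeeping]: one composition; no estimate.  NOTHING of Bałaban's is asserted; NO weight of Bałaban's is bounded; NE7 ∕ NE7b ∕ NE7c NOT PRINTED for `d = 4` ∕ NOT
proved; no `Provisos₁₃CoPH` inhabitant claimed (K0⁷ OPEN); K3⁸ untouched; N20 NOT discharged; counts UNMOVED (typed 28∕28 · discharged 8∕27); one finite four-torus programme at
fixed `ε` — NOT ℝ⁴, NOT OS, NOT a mass gap, NOT the Clay problem.  No `def`, no `instance`, no `notation`, no `sorry`; no decl below carries a cite tag.
-/

noncomputable section

open MeasureTheory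
open scoped BigOperators
open Finset

namespace YMDAG.UVSplit

open Literature.MathematicalPhysics.QuantumFieldTheory.Balaban1983to89
open Literature.MathematicalPhysics.QuantumFieldTheory.Balaban1983to89.T4Continuum
open Literature.MathematicalPhysics.QuantumFieldTheory.Balaban1983to89.Node00
open Literature.MathematicalPhysics.QuantumFieldTheory.Balaban1983to89.B15.BasicStep (fibreIntegral)
open Summit.QuantumFields.YangMills.Theorems.N21ShellSplitOfRecord13CoPH (integrable_topPieceA_of_liveSel integrable_topPieceB_of_liveSel)
open T4WeightBudget (RelWeightBound)
open T4PersistenceDictionary (Gen PEv dictW)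
open T4BankedInduction (Banking credits lifeCost)
open T4PartnerMultiplicity (partnerAges)
open T4BranchingRecordsGas (relabel shape)
open T4PrintedShapeBanking (Consistent)
open T4CanonicalMenus (Chrono fuel canonFam birthMass birthMass_nonneg)

/-! ## §1 The face of record ON THE LIVE LINE with item (a′) in print's UNDRESSED currency -/

section Face

variable {F : T4Family}

open scoped Classical in
/-- ★★★ **THE N20 FACE OF RECORD ON THE LIVE LINE, ITEM (a′) IN PRINT'S UNDRESSED CURRENCY** (✓`…_ofRecord_perRegionAE` ∘ `…N20DressedLettersOfUndressedAE`).  For print's valid constants `C₀`,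
`β₀ ≥ 0`, a window exponent `r` with `r(q′+1) < p₀`, ANY `M ≥ 0` and `η̄₊ > 0` there are margins `κ₁, E₀ ≥ 0` with `L^4·e^{η̄₊−κ₁} < 1` and a coupling ceiling `γ₀ > 0` — BEFORE the
rank and the carriers — such that for every rank, carrier tuple `(θ, hP, K₀, g₀, os, kr, bd)`, cut, slopes, histories of record in `]0, γ₀]` obeying (2.7), ON THE LIVE LINE — the
tuple's residual selector IS the live selector of record (`θ.ppSel = ppSelLiveOfRecord (EOfRecord₁₃ θ) (wOfRecord₉ θ)`, K3⁸'s `LiveSel`), (H-U) `LocalBgMeasurable θ.ν`, the sign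
law `0 ≤ θ.ζ` —, caps, and, per cutoff `K` ONLY (no source `t`, no loop string enters): a removal SCHEDULE per bad history with ONE-COMPONENT LETTERS `dV`-ALMOST EVERYWHERE ON
THE RECORD'S OWN UNDRESSED post-𝐑 (2.18) SLOTS `u = slotsOfRecord … (EOfRecord₁₃ θ) (wOfRecord₉ θ) θ.ppSel (run) (hist)` — link `i` of `s` removes `Y = comp s i` on its fibre
`fibY Y`: `∫⌈_{fibY Y} χ(u_i)·u(u_i) ≤ e^{−2}·e^{−credits(G Y)}·e^{+lifeCost(G Y)}·∫⌈_{fibY Y} χ(u_{i+1})·u(u_{i+1})` for `dV`-a.e. configuration ([LF-II] p. 387 l. 23–29: (1.79)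
per large field region with the improved (1.89), on [IV] (0.3)'s fibre, at law level, ON PRINT'S OWN TERMS — no dressing; the constant `e^{−2}` is the whole price of the
dressing `|t| ≤ 1`, `|F_os| ≤ 1`) —, good ends, filing in `Old`, data and labels (b), multiplicities (ID) give `RelWeightBound 1 … (K ↦ 1 − exp(−S_K))` EXACTLY as in
✓`…_ofRecord_perRegionAE`.  GONE against it: the source `t` and the loop string `os` from item (a′) and from the schedules; the four regularity rows (C) (measurability ∕
integrability of the dressed pieces of both runs — theorems on the live line: `measurable_chi_mul_dressedSlotsOfDatum₉_A∕_B`, dag-n21-d's `integrable_topPieceA∕B_of_liveSel`).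
IN: the three live-line rows (K3⁸'s own).  Proof: ✓`…_ofRecord_perRegionAE` with, per `(K, t)`, the `t`-free data and each dressed link letter from the undressed one
(`dressedLetterAE_of_undressedLetterAE_A∕_B`). [bookkeeping] -/
theorem exists_margins_smallCoupling_relWeightBound_chronoGenealogies_ofRecord_undressedAE_of_liveSel {X : Type*} (C₀ : T4PrintedShapeBanking.Consts) (hCv : C₀.Valid) (ha : 0 < C₀.a)
    (hA : 0 < C₀.A₀) (hμ₀ : 0 < C₀.μ) {r : ℕ} {β₀ : ℝ} (hβ : 0 ≤ β₀) (hrq : r * (C₀.q' + 1) < C₀.p₀) {M ηplus : ℝ} (hM : 0 ≤ M) (hη : 0 < ηplus) :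
    ∃ κ₁ E₀ γ₀ : ℝ, 0 ≤ κ₁ ∧ 0 ≤ E₀ ∧ 0 < γ₀ ∧ (F.L : ℝ) ^ 4 * Real.exp (ηplus - κ₁) < 1 ∧
      ∀ {N : ℕ} [NeZero N] (θ : Stage13HParams F N) (hP : θ.Provisos₁₃CoPH F N) (K₀ : ℕ) (g₀ : ℕ → ℝ) (os : List (ULoop F))
      (kr : ℕ → (Σ K, SiteSeqKey F (K₀ + K)) → (Σ K, SiteSeqKey F (K₀ + K))) (bd : ℕ → (Σ K, SiteSeqKey F (K₀ + K)) → Prop) (c : ℝ), 0 < c →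
      ∀ (jstar : ℕ → ℕ), (∀ K, jstar K ≤ K) → (∀ K : ℕ, c * K ≤ ((K - jstar K : ℕ) : ℝ)) →
      ∀ (β' : ℕ → ℝ), (∀ K, 0 ≤ β' K) → 1 + β₀ ≤ (F.L : ℝ) →
        (∀ K, Step.InInterval γ₀ (K₀ + K) (histA₁₃ θ K₀ g₀ K)) → (∀ K, B14.FlowIneq27 (histA₁₃ θ K₀ g₀ K) (β' K) β₀ C₀.p₀ (K₀ + K)) →
      θ.ppSel = ppSelLiveOfRecord F N θ.ν θ.τ9 (EOfRecord₁₃ F N θ.toStage13Params) (wOfRecord₉ F N θ.toStage9Params) → LocalBgMeasurable F N θ.ν →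
      (∀ p g k s Pl Ql RS U V', 0 ≤ θ.ζ p g k s Pl Ql RS U V') →
      ∀ (Dcap Ncap : ℕ → ℕ),
      (∀ (K : ℕ),
        ∃ (n : SeqOfRecord F θ.ν θ.τ9.M (histA₁₃ θ K₀ g₀ K) (K₀ + K) (K₀ + K) → ℕ)
          (chain : (s : SeqOfRecord F θ.ν θ.τ9.M (histA₁₃ θ K₀ g₀ K) (K₀ + K) (K₀ + K)) → Fin (n s + 1) → SeqOfRecord F θ.ν θ.τ9.M (histA₁₃ θ K₀ g₀ K) (K₀ + K) (K₀ + K))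
          (comp : (s : SeqOfRecord F θ.ν θ.τ9.M (histA₁₃ θ K₀ g₀ K) (K₀ + K) (K₀ + K)) → Fin (n s) → X)
          (fibY : X → Finset (PBond (F.P (K₀ + K)) (K₀ + K)))
          (Old : SeqOfRecord F θ.ν θ.τ9.M (histA₁₃ θ K₀ g₀ K) (K₀ + K) (K₀ + K) → Finset X)
          (slot : X → (Σ _ : ℕ, (Fin 4 → ℕ))) (G : X → Gen PEv),
          (∀ s, kr K (keyA₁₃ θ K₀ g₀ K s) ∈ badClassK₁₃ θ K₀ g₀ kr bd K 0 → chain s 0 = s) ∧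
          (∀ s, kr K (keyA₁₃ θ K₀ g₀ K s) ∈ badClassK₁₃ θ K₀ g₀ kr bd K 0 → ∀ i : Fin (n s), ∀ᵐ V ∂fieldMeasure (F.P (K₀ + K)) (K₀ + K) (SU N),
            fibreIntegral (fibY (comp s i)) (fun V => chiSeqOfRecord F N θ.ν θ.τ9.M (histA₁₃ θ K₀ g₀ K) (K₀ + K) (K₀ + K) (chain s i.castSucc) V *
                slotsOfRecord F N θ.ν θ.τ9 (EOfRecord₁₃ F N θ.toStage13Params) (wOfRecord₉ F N θ.toStage9Params) θ.ppSel (runA₁₃ F K₀ g₀ K) (histA₁₃ θ K₀ g₀ K) (K₀ + K) (chain s i.castSucc) V) V ≤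
              Real.exp (-2) * (Real.exp (-credits (T4PrintedShapeBanking.credit C₀ (fun j => histA₁₃ θ K₀ g₀ K (min j (K₀ + K)))) (G (comp s i))) *
              Real.exp (lifeCost (dictW (fun s => RkOfRecord F.L r (histA₁₃ θ K₀ g₀ K s)) C₀.n₁) (T4PrintedShapeBanking.cost C₀ (K₀ + K) (fun s => RkOfRecord F.L r (histA₁₃ θ K₀ g₀ K s))) (G (comp s i)))) *
              fibreIntegral (fibY (comp s i)) (fun V => chiSeqOfRecord F N θ.ν θ.τ9.M (histA₁₃ θ K₀ g₀ K) (K₀ + K) (K₀ + K) (chain s i.succ) V *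
                slotsOfRecord F N θ.ν θ.τ9 (EOfRecord₁₃ F N θ.toStage13Params) (wOfRecord₉ F N θ.toStage9Params) θ.ppSel (runA₁₃ F K₀ g₀ K) (histA₁₃ θ K₀ g₀ K) (K₀ + K) (chain s i.succ) V) V) ∧
          (∀ s, kr K (keyA₁₃ θ K₀ g₀ K s) ∈ badClassK₁₃ θ K₀ g₀ kr bd K 0 → kr K (keyA₁₃ θ K₀ g₀ K (chain s (Fin.last (n s)))) ∉ badClassK₁₃ θ K₀ g₀ kr bd K 0) ∧
          (∀ σ s, kr K (keyA₁₃ θ K₀ g₀ K s) ∈ badClassK₁₃ θ K₀ g₀ kr bd K 0 → chain s (Fin.last (n s)) = σ →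
            (∀ i, comp s i ∈ Old σ) ∧ 0 < n s ∧ Function.Injective (comp s)) ∧
          (∀ σ, Set.InjOn (fun s => (Finset.univ : Finset (Fin (n s))).image (comp s)) {s | kr K (keyA₁₃ θ K₀ g₀ K s) ∈ badClassK₁₃ θ K₀ g₀ kr bd K 0 ∧ chain s (Fin.last (n s)) = σ}) ∧
          (∀ σ, ∀ Y ∈ Old σ, (slot Y).1 < K₀ + jstar K) ∧
          (∀ σ, ∀ Y ∈ Old σ, (slot Y).2 ∈ Fintype.piFinset fun _ : Fin 4 => Finset.range (2 * F.L ^ F.m * F.L ^ ((K₀ + K) - (slot Y).1))) ∧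
          (∀ σ, ∀ Y ∈ Old σ, Consistent C₀ (K₀ + K) (fun s => RkOfRecord F.L r (histA₁₃ θ K₀ g₀ K s)) (G Y)) ∧
          (∀ σ, ∀ Y ∈ Old σ, (G Y).WF (dictW (fun s => RkOfRecord F.L r (histA₁₃ θ K₀ g₀ K s)) C₀.n₁)) ∧
          (∀ σ, ∀ Y ∈ Old σ, K₀ + K < (G Y).reach (dictW (fun s => RkOfRecord F.L r (histA₁₃ θ K₀ g₀ K s)) C₀.n₁)) ∧ (∀ σ, ∀ Y ∈ Old σ, Chrono PEv.step (G Y)) ∧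
          (∀ σ, ∀ Y ∈ Old σ, ∀ e ∈ (G Y).events, e.kind = 0 → e.fat < Dcap (K₀ + K)) ∧ (∀ σ, ∀ Y ∈ Old σ, fuel (G Y) ≤ Ncap (K₀ + K)) ∧
          (∀ σ, ∀ Y ∈ Old σ, (G Y).rootStep = (slot Y).1) ∧
          (∀ σ, ∀ j < K₀ + jstar K, ∀ zc ∈ (Fintype.piFinset fun _ : Fin 4 => Finset.range (2 * F.L ^ F.m * F.L ^ ((K₀ + K) - j))),
            ∀ G₀ ∈ canonFam Dcap Ncap (K₀ + K) j,
            ((((Old σ).filter fun Y => slot Y = ⟨j, zc⟩ ∧ relabel shape (G Y) = G₀).card : ℕ) : ℝ) ≤ M ^ partnerAges PEv.step G₀)) →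
      (∀ (K : ℕ),
        ∃ (n : SeqOfRecord F θ.ν θ.τ9.M (histB₁₃ θ K₀ g₀ K) (K₀ + K + 1) (K₀ + K + 1) → ℕ)
          (chain : (s : SeqOfRecord F θ.ν θ.τ9.M (histB₁₃ θ K₀ g₀ K) (K₀ + K + 1) (K₀ + K + 1)) → Fin (n s + 1) → SeqOfRecord F θ.ν θ.τ9.M (histB₁₃ θ K₀ g₀ K) (K₀ + K + 1) (K₀ + K + 1))
          (comp : (s : SeqOfRecord F θ.ν θ.τ9.M (histB₁₃ θ K₀ g₀ K) (K₀ + K + 1) (K₀ + K + 1)) → Fin (n s) → X)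
          (fibY : X → Finset (PBond (F.P (K₀ + K + 1)) (K₀ + K + 1)))
          (Old : SeqOfRecord F θ.ν θ.τ9.M (histB₁₃ θ K₀ g₀ K) (K₀ + K + 1) (K₀ + K + 1) → Finset X)
          (slot : X → (Σ _ : ℕ, (Fin 4 → ℕ))) (G : X → Gen PEv),
          (∀ s', kr K (keyB₁₃ θ K₀ g₀ K s') ∈ badClassK₁₃ θ K₀ g₀ kr bd K 0 → chain s' 0 = s') ∧
          (∀ s', kr K (keyB₁₃ θ K₀ g₀ K s') ∈ badClassK₁₃ θ K₀ g₀ kr bd K 0 → ∀ i : Fin (n s'), ∀ᵐ V ∂fieldMeasure (F.P (K₀ + K + 1)) (K₀ + K + 1) (SU N),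
            fibreIntegral (fibY (comp s' i)) (fun V => chiSeqOfRecord F N θ.ν θ.τ9.M (histB₁₃ θ K₀ g₀ K) (K₀ + K + 1) (K₀ + K + 1) (chain s' i.castSucc) V *
                slotsOfRecord F N θ.ν θ.τ9 (EOfRecord₁₃ F N θ.toStage13Params) (wOfRecord₉ F N θ.toStage9Params) θ.ppSel (runB₁₃ F K₀ g₀ K) (histB₁₃ θ K₀ g₀ K) (K₀ + K + 1) (chain s' i.castSucc) V) V ≤
              Real.exp (-2) * (Real.exp (-credits (T4PrintedShapeBanking.credit C₀ (fun j => histB₁₃ θ K₀ g₀ K (min j (K₀ + K + 1)))) (G (comp s' i))) *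
              Real.exp (lifeCost (dictW (fun s => RkOfRecord F.L r (histB₁₃ θ K₀ g₀ K s)) C₀.n₁) (T4PrintedShapeBanking.cost C₀ (K₀ + K + 1) (fun s => RkOfRecord F.L r (histB₁₃ θ K₀ g₀ K s))) (G (comp s' i)))) *
              fibreIntegral (fibY (comp s' i)) (fun V => chiSeqOfRecord F N θ.ν θ.τ9.M (histB₁₃ θ K₀ g₀ K) (K₀ + K + 1) (K₀ + K + 1) (chain s' i.succ) V *
                slotsOfRecord F N θ.ν θ.τ9 (EOfRecord₁₃ F N θ.toStage13Params) (wOfRecord₉ F N θ.toStage9Params) θ.ppSel (runB₁₃ F K₀ g₀ K) (histB₁₃ θ K₀ g₀ K) (K₀ + K + 1) (chain s' i.succ) V) V) ∧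
          (∀ s', kr K (keyB₁₃ θ K₀ g₀ K s') ∈ badClassK₁₃ θ K₀ g₀ kr bd K 0 → kr K (keyB₁₃ θ K₀ g₀ K (chain s' (Fin.last (n s')))) ∉ badClassK₁₃ θ K₀ g₀ kr bd K 0) ∧
          (∀ σ s', kr K (keyB₁₃ θ K₀ g₀ K s') ∈ badClassK₁₃ θ K₀ g₀ kr bd K 0 → chain s' (Fin.last (n s')) = σ →
            (∀ i, comp s' i ∈ Old σ) ∧ 0 < n s' ∧ Function.Injective (comp s')) ∧
          (∀ σ, Set.InjOn (fun s' => (Finset.univ : Finset (Fin (n s'))).image (comp s')) {s' | kr K (keyB₁₃ θ K₀ g₀ K s') ∈ badClassK₁₃ θ K₀ g₀ kr bd K 0 ∧ chain s' (Fin.last (n s')) = σ}) ∧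
          (∀ σ, ∀ Y ∈ Old σ, (slot Y).1 < K₀ + jstar K + 1) ∧
          (∀ σ, ∀ Y ∈ Old σ, (slot Y).2 ∈ Fintype.piFinset fun _ : Fin 4 => Finset.range (2 * F.L ^ F.m * F.L ^ ((K₀ + K + 1) - (slot Y).1))) ∧
          (∀ σ, ∀ Y ∈ Old σ, Consistent C₀ (K₀ + K + 1) (fun s => RkOfRecord F.L r (histB₁₃ θ K₀ g₀ K s)) (G Y)) ∧
          (∀ σ, ∀ Y ∈ Old σ, (G Y).WF (dictW (fun s => RkOfRecord F.L r (histB₁₃ θ K₀ g₀ K s)) C₀.n₁)) ∧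
          (∀ σ, ∀ Y ∈ Old σ, K₀ + K + 1 < (G Y).reach (dictW (fun s => RkOfRecord F.L r (histB₁₃ θ K₀ g₀ K s)) C₀.n₁)) ∧ (∀ σ, ∀ Y ∈ Old σ, Chrono PEv.step (G Y)) ∧
          (∀ σ, ∀ Y ∈ Old σ, ∀ e ∈ (G Y).events, e.kind = 0 → e.fat < Dcap (K₀ + K + 1)) ∧ (∀ σ, ∀ Y ∈ Old σ, fuel (G Y) ≤ Ncap (K₀ + K + 1)) ∧
          (∀ σ, ∀ Y ∈ Old σ, (G Y).rootStep = (slot Y).1) ∧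
          (∀ σ, ∀ j < K₀ + jstar K + 1, ∀ zc ∈ (Fintype.piFinset fun _ : Fin 4 => Finset.range (2 * F.L ^ F.m * F.L ^ ((K₀ + K + 1) - j))),
            ∀ G₀ ∈ canonFam Dcap Ncap (K₀ + K + 1) j,
            ((((Old σ).filter fun Y => slot Y = ⟨j, zc⟩ ∧ relabel shape (G Y) = G₀).card : ℕ) : ℝ) ≤ M ^ partnerAges PEv.step G₀)) →
      RelWeightBound 1 (classSetK₁₃ θ K₀ g₀ kr) (weightAK₁₃ θ hP K₀ g₀ os kr) (weightBK₁₃ θ hP K₀ g₀ os kr) (badClassK₁₃ θ K₀ g₀ kr bd)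
        (fun K => 1 - Real.exp (-(birthMass C₀ * Real.exp (-κ₁) * (((2 * F.L ^ F.m : ℕ) : ℝ) ^ 4) *
          ((((F.L : ℝ) ^ 4) * Real.exp (ηplus - κ₁)) ^ (K - jstar K + 1) / (1 - ((F.L : ℝ) ^ 4) * Real.exp (ηplus - κ₁)))))) := by
  obtain ⟨κ₁, E₀, γ₀, hκ, hE, hγ, hr, hx₀⟩ :=
    exists_margins_smallCoupling_relWeightBound_chronoGenealogies_ofRecord_perRegionAE (F := F) (X := X) C₀ hCv ha hA hμ₀ hβ hrq hM hη
  refine ⟨κ₁, E₀, γ₀, hκ, hE, hγ, hr, ?_⟩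
  intro N _ θ hP K₀ g₀ os kr bd c hc jstar hjK hfrac β' hβ' hβL hI h27 hsel hU hζsign Dcap Ncap hLA hLB
  refine hx₀ θ hP K₀ g₀ os kr bd c hc jstar hjK hfrac β' hβ' hβL hI h27 Dcap Ncap
    (fun K t s => measurable_chi_mul_dressedSlotsOfDatum₉_A θ hP K₀ g₀ os hU K t (K₀ + K) s)
    (fun K t s => integrable_topPieceA_of_liveSel K₀ θ hP (EOfRecord₁₃ F N θ.toStage13Params) hsel hU hP.zetaMeas hζsign g₀ os K t s)
    (fun K t s' => measurable_chi_mul_dressedSlotsOfDatum₉_B θ hP K₀ g₀ os hU K t (K₀ + K + 1) s')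
    (fun K t s' => integrable_topPieceB_of_liveSel K₀ θ hP (EOfRecord₁₃ F N θ.toStage13Params) hsel hU hP.zetaMeas hζsign g₀ os K t s') ?_ ?_
  · -- run A: the data are the `t`-free data; each dressed link letter from the undressed one (§2)
    intro K t ht
    obtain ⟨n, chain, comp, fibY, Old, slot, G, h0, hlink, hgood, hφ, hinj, hslot1, hslot2, hcons, hWF, hreach, hchr, hfat, hfuel, hroot, hID⟩ := hLA K
    exact ⟨n, chain, comp, fibY, Old, slot, G, h0, fun s hs i =>
      dressedLetterAE_of_undressedLetterAE_A θ hP K₀ g₀ os hsel hU hζsign K ht (fibY (comp s i)) (chain s i.castSucc) (chain s i.succ) (by positivity)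
        (hlink s hs i), hgood, hφ, hinj, hslot1, hslot2, hcons, hWF, hreach, hchr, hfat, hfuel, hroot, hID⟩
  · -- run B: the same
    intro K t ht
    obtain ⟨n, chain, comp, fibY, Old, slot, G, h0, hlink, hgood, hφ, hinj, hslot1, hslot2, hcons, hWF, hreach, hchr, hfat, hfuel, hroot, hID⟩ := hLB K
    exact ⟨n, chain, comp, fibY, Old, slot, G, h0, fun s' hs i =>
      dressedLetterAE_of_undressedLetterAE_B θ hP K₀ g₀ os hsel hU hζsign K ht (fibY (comp s' i)) (chain s' i.castSucc) (chain s' i.succ) (by positivity)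
        (hlink s' hs i), hgood, hφ, hinj, hslot1, hslot2, hcons, hWF, hreach, hchr, hfat, hfuel, hroot, hID⟩

end Face

end YMDAG.UVSplit
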